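import Literature.GroupTheory.CombinatorialGroupTheory.RandomSclFreeGroupMatchedChunks
import HarnessLib

/-!
# Random rigidity of scl (Calegari–Walker 2013): proofs, part 14 — tripod systems

D. Calegari, A. Walker, *Random rigidity in the free group*, Geom. Topol. 17 (2013)
[CalegariWalker2013], §4.2–§4.3: the sharp upper bound `scl(v) log n / n ≤ log(2k−1)/6 + ε` is
certified by a (nearly) trivalent fatgraph whose edges are joints (matched pairs `x`, `X` of
subwords of length `L`) and whose vertices are tripods (Def. 4.3): three corners of the boundary
`x|Y`, `y|Z`, `z|X` at which an incoming joint side is immediately followed by an outgoing one.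

In the letter-pairing model (`commutatorLength_le_of_isPairing`: `4 cl(W) + 2 #orbits(τ) ≤ |W| + 2`
for the vertex permutation `τ = π ∘ rotate`), a joint of length `ℓ + 1` contributes `ℓ` orbits of
size `2` (`commutatorLength_le_of_matchedChunks`) and a tripod contributes one orbit of size `3`
(its three corners). Here we add the tripod credit:

* **`orbitCount_ge_of_orbitReps`** — a set of points pairwise in different cycles has at most
  `orbitCount` elements.
* **`commutatorLength_le_of_tripodSystem`** — matched chunks `P` as in
  `commutatorLength_le_of_matchedChunks` plus an injective family of `t` tripods (triples of
  corners, corner `i` = end of the incoming occurrence `C (r, i)` immediately followed by the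
  start of the partner of `C (r, i+1)`): `4 cl(W) + 2 ℓ M + 2 t ≤ |W| + 2`.
  For a complete cubic system (`|W| = 2(ℓ+1)M`, `t = 2M/3`) this is `4 cl(W) ≤ t + 2`, i.e.
  `−χ/2` of the trivalent fatgraph.
-/

noncomputable section

namespace Literature.GroupTheory.CombinatorialGroupTheory

section OrbitReps

/-- **Orbit representatives.** If the elements of `X` lie in pairwise different cycles of `τ`
then `#X ≤ orbitCount τ`. [folklore] -/
theorem orbitCount_ge_of_orbitReps {N : ℕ} (τ : Equiv.Perm (Fin N)) (X : Finset (Fin N))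
    (hX : ∀ x ∈ X, ∀ x' ∈ X, τ.SameCycle x x' → x = x') :
    X.card ≤ orbitCount τ := by
  classical
  rw [← card_image_cycleLabel τ]
  refine le_trans ?_ (Finset.card_le_card (Finset.image_subset_image (Finset.subset_univ X)))
  rw [Finset.card_image_of_injOn]
  intro x hx x' hx' h
  rw [Finset.mem_coe] at hx hx'
  simp only [Prod.mk.injEq] at h
  by_cases hfx : τ x = x
  · have h2 := h.2
    rw [if_pos hfx] at h2
    by_cases hfx' : τ x' = x'
    · rw [if_pos hfx'] at h2
      exact Option.some_injective _ h2
    · rw [if_neg hfx'] at h2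
      exact absurd h2 (Option.some_ne_none x)
  · have h2 := h.2
    rw [if_neg hfx] at h2
    have hfx' : τ x' ≠ x' := by
      intro h'
      rw [if_pos h'] at h2
      exact Option.some_ne_none x' h2.symm
    have hsame : τ.SameCycle x x' := by
      have hmem : x' ∈ (τ.cycleOf x').support := by
        rw [Equiv.Perm.mem_support, Equiv.Perm.cycleOf_apply_self]
        exact hfx'
      rw [← h.1, Equiv.Perm.mem_support_cycleOf_iff] at hmem
      exact hmem.1
    exact hX x hx x' hx' hsame

end OrbitReps

section Tripods

open Equiv

/-- **An upper bound for `cl` from a tripod system (CW §4.3, letter level).** Data: matched chunks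
`P : Fin M × Fin (ℓ+1) × Bool ↪ Fin |W|` as in `commutatorLength_le_of_matchedChunks` (consecutive,
side `true` read backwards is the inverse of side `false`), and `t` tripods
`C : Fin t × Fin 3 ↪ Fin M × Bool` (corner `i` of tripod `r` is the end of the occurrence
`C (r, i)`, immediately followed in `W` by the start of the partner occurrence of `C (r, i+1)`).
Then `4 · cl(W) + 2 ℓ M + 2 t ≤ |W| + 2`. [cite: CalegariWalker2013, §4.2–§4.3] -/
theorem commutatorLength_le_of_tripodSystem {α : Type*} [DecidableEq α] (W : List (α × Bool))
    (hW : FreeGroup.mk W ∈ commutator (FreeGroup α)) (ℓ M : ℕ)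
    (P : Fin M × Fin (ℓ + 1) × Bool → Fin W.length) (hP : Function.Injective P)
    (hPq : ∀ r q b, ((P (r, q, b) : Fin W.length) : ℕ) = (P (r, 0, b) : ℕ) + q)
    (hinv : ∀ r (q : Fin (ℓ + 1)), W.get (P (r, ⟨ℓ - q, by omega⟩, true)) =
      ((W.get (P (r, q, false))).1, !(W.get (P (r, q, false))).2))
    (t : ℕ) (C : Fin t × Fin 3 → Fin M × Bool) (hC : Function.Injective C)
    (hadj : ∀ r (i : Fin 3), ((P ((C (r, i)).1, ⟨ℓ, by omega⟩, (C (r, i)).2) : Fin W.length) : ℕ) + 1 =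
      (P ((C (r, i + 1)).1, 0, !(C (r, i + 1)).2) : ℕ)) :
    4 * commutatorLength (FreeGroup.mk W) + 2 * ℓ * M + 2 * t ≤ W.length + 2 := by
  classical
  -- without tripods this is the matched-chunk bound
  rcases Nat.eq_zero_or_pos t with ht | ht
  · subst ht
    have := commutatorLength_le_of_matchedChunks W hW ℓ M P hP hPq hinv
    omega
  have hn : 0 < W.length := by
    have := (P ((C (⟨0, ht⟩, 0)).1, 0, (C (⟨0, ht⟩, 0)).2)).isLt
    omega
  -- the partner map on the chunks
  let swap : Fin M × Fin (ℓ + 1) × Bool → Fin M × Fin (ℓ + 1) × Bool :=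
    fun t => (t.1, ⟨ℓ - t.2.1, by omega⟩, !t.2.2)
  have hswap2 : ∀ t, swap (swap t) = t := by
    rintro ⟨r, q, b⟩
    simp only [swap, Bool.not_not, Prod.mk.injEq, true_and]
    exact ⟨Fin.ext (by simp only; omega), trivial⟩
  have hswapne : ∀ t, swap t ≠ t := by
    rintro ⟨r, q, b⟩ h
    simp only [swap, Prod.mk.injEq] at h
    exact Bool.not_ne_self b h.2.2
  have hinv' : ∀ t, W.get (P (swap t)) = ((W.get (P t)).1, !(W.get (P t)).2) := by
    rintro ⟨r, q, b⟩
    cases b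
    · exact hinv r q
    · simp only [swap, Bool.not_true]
      have h := hinv r ⟨ℓ - q, by omega⟩
      have e : (⟨ℓ - (ℓ - (q : ℕ)), by omega⟩ : Fin (ℓ + 1)) = q := Fin.ext (by simp only; omega)
      simp only [e] at h
      rw [h]
      simp
  set S : Finset (Fin W.length) := Finset.univ.image P with hS
  let p : Fin W.length → Fin W.length := fun x =>
    if h : ∃ t, P t = x then P (swap h.choose) else x
  have hpP : ∀ t, p (P t) = P (swap t) := by
    intro t
    have h : ∃ t', P t' = P t := ⟨t, rfl⟩
    simp only [p, dif_pos h]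
    rw [hP h.choose_spec]
  have hmemS : ∀ x, x ∈ S ↔ ∃ t, P t = x := fun x => by
    rw [hS, Finset.mem_image]; simp
  obtain ⟨π, hπ, hπS⟩ := exists_isPairing_extension W hW S p
    (fun x hx => by
      obtain ⟨t, rfl⟩ := (hmemS x).mp hx
      rw [hpP]; exact (hmemS _).mpr ⟨swap t, rfl⟩)
    (fun x hx => by
      obtain ⟨t, rfl⟩ := (hmemS x).mp hx
      rw [hpP, hpP, hswap2])
    (fun x hx => by
      obtain ⟨t, rfl⟩ := (hmemS x).mp hx
      rw [hpP]; exact fun h => hswapne t (hP h))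
    (fun x hx => by
      obtain ⟨t, rfl⟩ := (hmemS x).mp hx
      rw [hpP]; exact hinv' t)
  have hπP : ∀ t, π (P t) = P (swap t) := fun t => by
    rw [hπS _ ((hmemS _).mpr ⟨t, rfl⟩), hpP]
  -- the vertex permutation
  set τ : Equiv.Perm (Fin W.length) := (finRotate W.length).trans π with hτ
  have hmain := commutatorLength_le_of_isPairing W π hπ
  -- `fr (P (r, q, b)) = P (r, q+1, b)` inside a chunk
  have hfr : ∀ r (q : Fin (ℓ + 1)) b (hq : (q : ℕ) + 1 < ℓ + 1),
      finRotate W.length (P (r, q, b)) = P (r, ⟨q + 1, hq⟩, b) := by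
    intro r q b hq
    apply Fin.ext
    rw [val_finRotate hn, hPq r ⟨q + 1, hq⟩ b, hPq r q b]
    have := (P (r, ⟨q + 1, hq⟩, b)).isLt
    rw [hPq r ⟨q + 1, hq⟩ b] at this
    simp only at this ⊢
    rw [Nat.mod_eq_of_lt (by omega)]
    omega
  have hτP : ∀ r (q q' : Fin (ℓ + 1)) b, (q : ℕ) + 1 ≤ ℓ → (q' : ℕ) = ℓ - (q + 1) →
      τ (P (r, q, b)) = P (r, q', !b) := by
    intro r q q' b hq hq'
    have hq1 : (q : ℕ) + 1 < ℓ + 1 := by omega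
    rw [hτ, Equiv.trans_apply, hfr r q b hq1, hπP]
    show P (r, ⟨ℓ - ((q : ℕ) + 1), _⟩, !b) = P (r, q', !b)
    congr 3
    exact Fin.ext (show ℓ - ((q : ℕ) + 1) = (q' : ℕ) by omega)
  -- the corners: `τ (x r i) = x r (i+1)`
  let x : Fin t → Fin 3 → Fin W.length := fun r i => P ((C (r, i)).1, ⟨ℓ, by omega⟩, (C (r, i)).2)
  have hτx : ∀ r i, τ (x r i) = x r (i + 1) := by
    intro r i
    have hlt : ((x r i : Fin W.length) : ℕ) + 1 < W.length := by
      have h := hadj r i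
      have := (P ((C (r, i + 1)).1, 0, !(C (r, i + 1)).2)).isLt
      show ((P ((C (r, i)).1, ⟨ℓ, by omega⟩, (C (r, i)).2) : Fin W.length) : ℕ) + 1 < W.length
      omega
    have hfr' : finRotate W.length (x r i) = P ((C (r, i + 1)).1, 0, !(C (r, i + 1)).2) := by
      apply Fin.ext
      rw [val_finRotate hn, Nat.mod_eq_of_lt hlt]
      exact hadj r i
    rw [hτ, Equiv.trans_apply, hfr', hπP]
    show P ((C (r, i + 1)).1, ⟨ℓ - 0, _⟩, !!(C (r, i + 1)).2) = x r (i + 1)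
    simp only [Bool.not_not, Nat.sub_zero]
    rfl
  have hτx3 : ∀ r i, τ (τ (τ (x r i))) = x r i := by
    intro r i
    rw [hτx, hτx, hτx]
    have : i + 1 + 1 + 1 = i := by
      fin_cases i <;> rfl
    rw [this]
  have hxinj : ∀ r i r' i', x r i = x r' i' → (r, i) = (r', i') := by
    intro r i r' i' h
    have h' := hP h
    simp only [Prod.mk.injEq] at h'
    exact hC (Prod.ext h'.1 h'.2.2)
  -- the representatives: 2-cycle points and one corner per tripod
  set X₂ : Finset (Fin W.length) := (Finset.univ : Finset (Fin M × Fin ℓ)).image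
    fun rq => P (rq.1, rq.2.castSucc, false) with hX₂
  set X₃ : Finset (Fin W.length) := (Finset.univ : Finset (Fin t)).image fun r => x r 0 with hX₃
  have hX₂card : X₂.card = ℓ * M := by
    rw [hX₂, Finset.card_image_of_injective, Finset.card_univ, Fintype.card_prod,
      Fintype.card_fin, Fintype.card_fin, mul_comm]
    intro rq rq' h
    have h' := hP h
    simp only [Prod.mk.injEq, Fin.castSucc_inj] at h'
    exact Prod.ext h'.1 h'.2.1
  have hX₃card : X₃.card = t := by
    rw [hX₃, Finset.card_image_of_injective, Finset.card_univ, Fintype.card_fin]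
    intro r r' h
    have := hxinj r 0 r' 0 h
    simp only [Prod.mk.injEq, and_true] at this
    exact this
  -- no corner is a 2-cycle point or the partner of one
  have hx_ne_P : ∀ r i r' (q : Fin (ℓ + 1)) b, (q : ℕ) < ℓ → x r i ≠ P (r', q, b) := by
    intro r i r' q b hq h
    have h' := hP h
    simp only [Prod.mk.injEq] at h'
    have := congrArg Fin.val h'.2.1
    simp only at this
    omega
  have hdisj : Disjoint X₂ X₃ := by
    rw [Finset.disjoint_left]
    intro y hy2 hy3
    rw [hX₂, Finset.mem_image] at hy2
    rw [hX₃, Finset.mem_image] at hy3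
    obtain ⟨⟨r, q⟩, _, rfl⟩ := hy2
    obtain ⟨r', _, h⟩ := hy3
    exact hx_ne_P r' 0 r q.castSucc false (by rw [Fin.val_castSucc]; exact q.isLt) h
  -- powers of `τ` on the representatives
  have hpow2 : ∀ y, τ (τ y) = y → ∀ i : ℕ, (τ ^ i) y = y ∨ (τ ^ i) y = τ y := by
    intro y hy i
    induction i with
    | zero => left; simp
    | succ i ih =>
      rw [pow_succ', Equiv.Perm.mul_apply]
      rcases ih with h | h
      · right; rw [h]
      · left; rw [h, hy]
  have hpow3 : ∀ y, τ (τ (τ y)) = y → ∀ i : ℕ,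
      (τ ^ i) y = y ∨ (τ ^ i) y = τ y ∨ (τ ^ i) y = τ (τ y) := by
    intro y hy i
    induction i with
    | zero => left; simp
    | succ i ih =>
      rw [pow_succ', Equiv.Perm.mul_apply]
      rcases ih with h | h | h
      · right; left; rw [h]
      · right; right; rw [h]
      · left; rw [h, hy]
  -- the 2-cycle points
  have hX2τ : ∀ r (q : Fin ℓ), τ (P (r, q.castSucc, false)) = P (r, ⟨ℓ - (q + 1), by omega⟩, true) ∧
      τ (τ (P (r, q.castSucc, false))) = P (r, q.castSucc, false) := by
    intro r q
    have hq := q.isLt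
    have hqc : ((q.castSucc : Fin (ℓ + 1)) : ℕ) = q := Fin.val_castSucc q
    have h1 := hτP r q.castSucc ⟨ℓ - (q + 1), by omega⟩ false (by rw [hqc]; omega) (by rw [hqc])
    have h2 := hτP r ⟨ℓ - (q + 1), by omega⟩ q.castSucc (!false) (by simp only; omega)
      (by rw [hqc]; simp only; omega)
    refine ⟨h1, ?_⟩
    rw [h1, h2]
    simp
  -- the orbit-representative property
  have hrep : ∀ y ∈ X₂ ∪ X₃, ∀ y' ∈ X₂ ∪ X₃, τ.SameCycle y y' → y = y' := by
    intro y hy y' hy' hs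
    obtain ⟨i, _, hi⟩ := hs.exists_pow_eq'
    rw [Finset.mem_union] at hy hy'
    rcases hy with hy | hy
    · -- `y` is a 2-cycle point
      rw [hX₂, Finset.mem_image] at hy
      obtain ⟨⟨r, q⟩, _, rfl⟩ := hy
      obtain ⟨h1, h2⟩ := hX2τ r q
      rcases hpow2 _ h2 i with h | h
      · rw [← hi, h]
      · exfalso
        rw [h, h1] at hi
        -- `τ y = P (r, ℓ-(q+1), true)` is not a representative
        rcases hy' with hy' | hy'
        · rw [hX₂, Finset.mem_image] at hy'
          obtain ⟨⟨r', q'⟩, _, h'⟩ := hy'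
          rw [← hi] at h'
          have h'' := hP h'
          simp only [Prod.mk.injEq] at h''
          exact Bool.false_ne_true h''.2.2
        · rw [hX₃, Finset.mem_image] at hy'
          obtain ⟨r', _, h'⟩ := hy'
          rw [← hi] at h'
          exact hx_ne_P r' 0 r ⟨ℓ - (q + 1), by omega⟩ true (by simp only; omega) h'
    · -- `y` is a corner
      rw [hX₃, Finset.mem_image] at hy
      obtain ⟨r, _, rfl⟩ := hy
      have key : ∀ j : Fin 3, x r j = y' → x r 0 = y' := by
        intro j hj
        rcases hy' with hy' | hy'
        · exfalso
          rw [hX₂, Finset.mem_image] at hy'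
          obtain ⟨⟨r', q'⟩, _, h'⟩ := hy'
          exact hx_ne_P r j r' q'.castSucc false (by rw [Fin.val_castSucc]; exact q'.isLt)
            (hj.trans h'.symm)
        · rw [hX₃, Finset.mem_image] at hy'
          obtain ⟨r', _, h'⟩ := hy'
          have := hxinj r j r' 0 (hj.trans h'.symm)
          simp only [Prod.mk.injEq] at this
          rw [← h', this.1]
      rcases hpow3 _ (hτx3 r 0) i with h | h | h
      · exact key 0 (by rw [← hi, h])
      · exact key (0 + 1) (by rw [← hi, h, hτx])
      · exact key (0 + 1 + 1) (by rw [← hi, h, hτx, hτx])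
  have horb := orbitCount_ge_of_orbitReps τ (X₂ ∪ X₃) hrep
  rw [Finset.card_union_of_disjoint hdisj, hX₂card, hX₃card] at horb
  have hmain' : 4 * commutatorLength (FreeGroup.mk W) + 2 * orbitCount τ ≤ W.length + 2 := hmain
  have e2 : 2 * ℓ * M = 2 * (ℓ * M) := by ring
  omega

end Tripods

end Literature.GroupTheory.CombinatorialGroupTheory

end
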